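import Literature.NumberTheory.LFunctions.AndersonStarkLemma1
import Literature.NumberTheory.LFunctions.AndersonStarkLiouville
import HarnessLib

/-!
# Anderson–Stark's Theorem 1 for `L(x)`: the right vertical line `Re w = 3/4` under a one-sided bound

Topic `Literature/NumberTheory/LFunctions`. Everything in this file is PROVED (no definitions).

Companion of `AndersonStarkRightLine.lean` (the unconditional right line `Re w = 3/2`). In the
proof of Anderson–Stark's Theorem 1 (LNM 899, §4) one first reduces, by Landau's theorem, to the
case where `G` has no poles to the right of `σ₀`; for `L(x) = ∑_{n ≤ x} λ(n)` this is the case of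
a one-sided bound `A(u) = e^{−u/2}L(e^u) ≤ a` (or `≥ −a`), under which
`∫ A(u)e^{−su} du = ζ(1+2s)/((½+s)ζ(½+s))` converges absolutely on `0 < Re s < ½` (the tree's
`normalizedLiouville_laplace_of_oneSided`). Then the right vertical line of the Gaussian contour can
be taken at `Re s = ¼` (`w = ½ + s`, `Re w = ¾`), as in the tree's contour files
(`AndersonStarkContour.lean`, `AndersonStarkContourLimit.lean`: integrand
`Ψ(s) = ζ(1+2s)e^{εs²}e^{su₀}/((½+s)ζ(½+s))`), and Lemma 1
(`Literature.NumberTheory.LFunctions.AndersonStark1981_lemma1`, with `f = A`, `σ = a = ¼`) gives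

* `andersonStark_rightLineOneSided_tendsto` — for `x₀ > 0` not an integer, as `ε → 0⁺`,
  `∫ Ψ(¼ + iy) dy → 2π A(log x₀) = 2π L(x₀)/√x₀` (with `u₀ = log x₀`);
* `andersonStark_rightLineOneSided_integrable` — `Ψ(¼ + i·)` is integrable for `ε > 0`.

## References

* [AndersonStark1981] R. J. Anderson, H. M. Stark, *Oscillation theorems*, LNM 899 (1981), §4,
  Lemma 1 and Theorem 1 (proof: "By Landau's theorem, we may assume that there are no poles of
  `G(s)` in the region `σ₂ ≥ σ > σ₀`").
-/

noncomputable section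

open Complex Filter MeasureTheory Set
open scoped Real Topology

namespace Literature.NumberTheory.LFunctions

/-- `L(e^u)` is locally constant at `u₀ = log x₀` when `x₀ > 0` is not an integer (private copy of
the lemma of `AndersonStarkRightLine.lean`). [folklore] -/
private theorem liouvilleSum_exp_eventuallyEq' {x₀ : ℝ} (hx₀ : 0 < x₀) (hnat : ∀ n : ℕ, (n : ℝ) ≠ x₀) :
    (fun u : ℝ ↦ liouvilleSum (Real.exp u)) =ᶠ[𝓝 (Real.log x₀)] fun _ ↦ liouvilleSum x₀ := by
  set N : ℕ := ⌊x₀⌋₊ with hN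
  have h1 : (N : ℝ) < x₀ := lt_of_le_of_ne (Nat.floor_le hx₀.le) (hnat N)
  have h2 : x₀ < N + 1 := Nat.lt_floor_add_one x₀
  have hopen : IsOpen {u : ℝ | (N : ℝ) < Real.exp u ∧ Real.exp u < N + 1} :=
    (isOpen_lt continuous_const Real.continuous_exp).inter (isOpen_lt Real.continuous_exp continuous_const)
  have hmem : Real.log x₀ ∈ {u : ℝ | (N : ℝ) < Real.exp u ∧ Real.exp u < N + 1} := by
    simp only [mem_setOf_eq, Real.exp_log hx₀]; exact ⟨h1, h2⟩
  filter_upwards [hopen.mem_nhds hmem] with u hu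
  have hfl : ⌊Real.exp u⌋₊ = N := by
    rw [Nat.floor_eq_iff (Real.exp_pos u).le]
    exact ⟨hu.1.le, hu.2⟩
  rw [liouvilleSum_eq_liouvilleSum_floor (Real.exp u), hfl, hN, ← liouvilleSum_eq_liouvilleSum_floor]

section OneSided

variable {a : ℝ}

/-- Under a global one-sided bound on `A`, `u ↦ A(u) e^{−u/4}` is integrable (complex form).
[cite: AndersonStark1981, §4 Theorem 1 (proof)] -/
theorem integrable_normalizedLiouville_quarter
    (h : (∀ u, normalizedLiouville u ≤ a) ∨ (∀ u, -a ≤ normalizedLiouville u)) :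
    Integrable fun u : ℝ ↦ (normalizedLiouville u : ℂ) * (Real.exp (-(1 / 4 * u)) : ℂ) := by
  have h1 := (normalizedLiouville_laplace_of_oneSided h).1 (1 / 4) (by norm_num)
  refine h1.norm.mono' ((Complex.measurable_ofReal.comp measurable_normalizedLiouville).aestronglyMeasurable.mul
    (by fun_prop)) (Eventually.of_forall fun u ↦ le_of_eq ?_)
  rw [norm_mul, Complex.norm_real, Complex.norm_real, norm_mul]

/-- **The right line `Re w = ¾` of Anderson–Stark's Theorem 1 for `L(x)` under a one-sided bound**:
for `x₀ > 0` not an integer, as `ε → 0⁺`,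
`∫ ζ(1+2s)e^{εs²}e^{s log x₀}/((½+s)ζ(½+s)) dy → 2π L(x₀)/√x₀` (`s = ¼ + iy`; Lemma 1 for the
transform of `A(u) = e^{−u/2}L(e^u)` at its continuity point `u₀ = log x₀`).
[cite: AndersonStark1981, §4 Theorem 1 (proof) and Lemma 1] -/
theorem andersonStark_rightLineOneSided_tendsto
    (h : (∀ u, normalizedLiouville u ≤ a) ∨ (∀ u, -a ≤ normalizedLiouville u))
    {x₀ : ℝ} (hx₀ : 0 < x₀) (hnat : ∀ n : ℕ, (n : ℝ) ≠ x₀) :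
    Tendsto (fun ε : ℝ ↦ ∫ y : ℝ, riemannZeta (1 + 2 * ((1 / 4 : ℂ) + y * I)) *
        (cexp (ε * ((1 / 4 : ℂ) + y * I) ^ 2) * cexp (((1 / 4 : ℂ) + y * I) * Real.log x₀)) /
        ((1 / 2 + ((1 / 4 : ℂ) + y * I)) * riemannZeta (1 / 2 + ((1 / 4 : ℂ) + y * I))))
      (𝓝[>] 0) (𝓝 ((2 * π : ℂ) * ((((liouvilleSum x₀ : ℝ)) / Real.sqrt x₀ : ℝ) : ℂ))) := by
  set f : ℝ → ℂ := fun u ↦ (normalizedLiouville u : ℂ) with hf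
  have hint : Integrable fun u ↦ f u * (Real.exp (-(1 / 4 * u)) : ℂ) :=
    integrable_normalizedLiouville_quarter h
  have hLap := (normalizedLiouville_laplace_of_oneSided h).2
  -- continuity at `u₀ = log x₀`
  have hcont : ContinuousAt (fun u ↦ f u * (Real.exp (-(1 / 4 * u)) : ℂ)) (Real.log x₀) := by
    have hev : (fun u ↦ f u * (Real.exp (-(1 / 4 * u)) : ℂ)) =ᶠ[𝓝 (Real.log x₀)]
        fun u ↦ (liouvilleSum x₀ : ℂ) * ((Real.exp (-(u / 2)) : ℂ) * (Real.exp (-(1 / 4 * u)) : ℂ)) := by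
      filter_upwards [liouvilleSum_exp_eventuallyEq' hx₀ hnat] with u hu
      simp only [hf, normalizedLiouville, hu]
      push_cast
      ring
    refine ContinuousAt.congr ?_ hev.symm
    exact continuousAt_const.mul (by fun_prop)
  have hmain := AndersonStark1981_lemma1 (σ := 1 / 4) hint hcont (1 / 4)
  -- identify the integrands
  have heq : ∀ ε : ℝ, (∫ y : ℝ, riemannZeta (1 + 2 * ((1 / 4 : ℂ) + y * I)) *
      (cexp (ε * ((1 / 4 : ℂ) + y * I) ^ 2) * cexp (((1 / 4 : ℂ) + y * I) * Real.log x₀)) /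
      ((1 / 2 + ((1 / 4 : ℂ) + y * I)) * riemannZeta (1 / 2 + ((1 / 4 : ℂ) + y * I)))) =
      ∫ t : ℝ, (∫ u : ℝ, f u * cexp (-((((1 / 4 : ℝ) : ℂ) + t * I) * u))) *
        (cexp (ε * (((1 / 4 : ℝ) : ℂ) + t * I) ^ 2) * cexp ((((1 / 4 : ℝ) : ℂ) + t * I) * Real.log x₀)) := by
    intro ε
    refine integral_congr_ae (ae_of_all _ fun y ↦ ?_)
    simp only [hf]
    rw [hLap (1 / 4) y (by norm_num) (by norm_num)]
    have e1 : (1 : ℂ) + 2 * ((1 / 4 : ℂ) + y * I) = 2 * (1 / 2 + ((1 / 4 : ℝ) : ℂ) + y * I) := by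
      push_cast; ring
    have e2 : (1 / 2 : ℂ) + ((1 / 4 : ℂ) + y * I) = 1 / 2 + ((1 / 4 : ℝ) : ℂ) + y * I := by
      push_cast; ring
    have e3 : ((1 / 4 : ℂ) + y * I) = ((1 / 4 : ℝ) : ℂ) + y * I := by push_cast; ring
    rw [e1, e2, e3]
    ring
  simp_rw [heq]
  -- identify the limits
  have hlim : (2 * π : ℂ) * (Real.exp (1 / 4 * Real.log x₀) : ℂ) *
      (f (Real.log x₀) * (Real.exp (-(1 / 4 * Real.log x₀)) : ℂ)) =
      (2 * π : ℂ) * ((((liouvilleSum x₀ : ℝ)) / Real.sqrt x₀ : ℝ) : ℂ) := by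
    simp only [hf, normalizedLiouville_log hx₀]
    have hexp : Real.exp (1 / 4 * Real.log x₀) * Real.exp (-(1 / 4 * Real.log x₀)) = 1 := by
      rw [← Real.exp_add, add_neg_cancel, Real.exp_zero]
    have hexpC := congrArg (fun r : ℝ ↦ (r : ℂ)) hexp
    push_cast at hexpC ⊢
    linear_combination (2 * π * ((liouvilleSum x₀ : ℂ) / (Real.sqrt x₀ : ℂ))) * hexpC
  rw [hlim] at hmain
  exact hmain

/-- **Integrability on the right line `Re w = ¾`** under a one-sided bound: for `ε > 0` and real
`u₀`, `y ↦ ζ(1+2s)e^{εs²}e^{su₀}/((½+s)ζ(½+s))` (`s = ¼ + iy`) is integrable on `ℝ` (the `ζ`-quotient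
is the bounded continuous Laplace transform of `A e^{−u/4}`; `ζ(¾ + iy) ≠ 0` by Landau's theorem
under the bound; Gaussian majorant). [cite: AndersonStark1981, §4 Theorem 1 (proof)] -/
theorem andersonStark_rightLineOneSided_integrable
    (h : (∀ u, normalizedLiouville u ≤ a) ∨ (∀ u, -a ≤ normalizedLiouville u))
    (u₀ : ℝ) {ε : ℝ} (hε : 0 < ε) :
    Integrable fun y : ℝ ↦ riemannZeta (1 + 2 * ((1 / 4 : ℂ) + y * I)) *
        (cexp (ε * ((1 / 4 : ℂ) + y * I) ^ 2) * cexp (((1 / 4 : ℂ) + y * I) * u₀)) /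
        ((1 / 2 + ((1 / 4 : ℂ) + y * I)) * riemannZeta (1 / 2 + ((1 / 4 : ℂ) + y * I))) := by
  set f : ℝ → ℂ := fun u ↦ (normalizedLiouville u : ℂ) with hf
  have hint : Integrable fun u ↦ f u * (Real.exp (-(1 / 4 * u)) : ℂ) :=
    integrable_normalizedLiouville_quarter h
  have hLap := (normalizedLiouville_laplace_of_oneSided h).2
  -- the Mellin integrability `hI` on `Re w > 1/2` (for the non-vanishing of `ζ` there)
  have hI : ∀ σ : ℝ, 1 / 2 < σ →
      IntegrableOn (fun x ↦ (liouvilleSum x : ℝ) * x ^ (-(σ + 1))) (Set.Ioi 1) := by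
    intro σ hσ
    have h1 := (normalizedLiouville_laplace_of_oneSided h).1 (σ - 1 / 2) (by linarith)
    have h2 := (integrable_normalizedLiouville_damped_iff (σ - 1 / 2)).1 h1
    refine h2.congr_fun (fun x _ ↦ ?_) measurableSet_Ioi
    simp only; congr 2; ring
  set C : ℝ := ∫ u, ‖f u * (Real.exp (-(1 / 4 * u)) : ℂ)‖ with hC
  -- the bound on the quotient
  have hG : ∀ y : ℝ, ‖riemannZeta (1 + 2 * ((1 / 4 : ℂ) + y * I)) /
      ((1 / 2 + ((1 / 4 : ℂ) + y * I)) * riemannZeta (1 / 2 + ((1 / 4 : ℂ) + y * I)))‖ ≤ C := by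
    intro y
    have e1 : (1 : ℂ) + 2 * ((1 / 4 : ℂ) + y * I) = 2 * (1 / 2 + ((1 / 4 : ℝ) : ℂ) + y * I) := by
      push_cast; ring
    have e2 : (1 / 2 : ℂ) + ((1 / 4 : ℂ) + y * I) = 1 / 2 + ((1 / 4 : ℝ) : ℂ) + y * I := by
      push_cast; ring
    rw [e1, e2, ← hLap (1 / 4) y (by norm_num) (by norm_num)]
    refine (norm_integral_le_integral_norm _).trans (le_of_eq ?_)
    refine integral_congr_ae (ae_of_all _ fun u ↦ ?_)
    simp only [hf]
    rw [norm_mul, norm_mul, Complex.norm_exp, Complex.norm_real, Complex.norm_real,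
      Real.norm_of_nonneg (Real.exp_pos _).le]
    have hre : (-((((1 / 4 : ℝ) : ℂ) + y * I) * u)).re = -(1 / 4 * u) := by
      simp
    rw [hre]
  -- continuity
  have hcont : Continuous fun y : ℝ ↦ riemannZeta (1 + 2 * ((1 / 4 : ℂ) + y * I)) *
      (cexp (ε * ((1 / 4 : ℂ) + y * I) ^ 2) * cexp (((1 / 4 : ℂ) + y * I) * u₀)) /
      ((1 / 2 + ((1 / 4 : ℂ) + y * I)) * riemannZeta (1 / 2 + ((1 / 4 : ℂ) + y * I))) := by
    have hs : ∀ y : ℝ, (1 / 2 : ℂ) + ((1 / 4 : ℂ) + y * I) ≠ 1 := by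
      intro y hy; have := congrArg Complex.re hy; norm_num at this
    have hs2 : ∀ y : ℝ, (1 : ℂ) + 2 * ((1 / 4 : ℂ) + y * I) ≠ 1 := by
      intro y hy; have := congrArg Complex.re hy; norm_num at this
    have hs0 : ∀ y : ℝ, (1 / 2 : ℂ) + ((1 / 4 : ℂ) + y * I) ≠ 0 := by
      intro y hy; have := congrArg Complex.re hy; norm_num at this
    have hζ : ∀ y : ℝ, riemannZeta ((1 / 2 : ℂ) + ((1 / 4 : ℂ) + y * I)) ≠ 0 := fun y ↦
      riemannZeta_ne_zero_of_liouville_integrable hI (by norm_num)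
    have hζc : ContinuousOn riemannZeta {1}ᶜ := fun s hs1 ↦
      (differentiableAt_riemannZeta hs1).continuousAt.continuousWithinAt
    have hz1 : Continuous fun y : ℝ ↦ riemannZeta ((1 / 2 : ℂ) + ((1 / 4 : ℂ) + y * I)) :=
      hζc.comp_continuous (by fun_prop) fun y ↦ hs y
    have hz2 : Continuous fun y : ℝ ↦ riemannZeta (1 + 2 * ((1 / 4 : ℂ) + y * I)) :=
      hζc.comp_continuous (by fun_prop) fun y ↦ hs2 y
    refine Continuous.div (hz2.mul (by fun_prop)) ((by fun_prop : Continuous fun y : ℝ ↦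
      (1 / 2 : ℂ) + ((1 / 4 : ℂ) + y * I)).mul hz1) fun y ↦ mul_ne_zero (hs0 y) (hζ y)
  -- the Gaussian majorant
  have hK : ∀ y : ℝ, ‖cexp (ε * ((1 / 4 : ℂ) + y * I) ^ 2) * cexp (((1 / 4 : ℂ) + y * I) * u₀)‖ =
      Real.exp (ε * (1 / 4) ^ 2 + (1 / 4) * u₀) * Real.exp (-(ε * y ^ 2)) := by
    intro y
    have e3 : ((1 / 4 : ℂ) + y * I) = ((1 / 4 : ℝ) : ℂ) + y * I := by push_cast; ring
    rw [e3]
    exact norm_gaussKernel ε (1 / 4) u₀ y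
  have hmaj : Integrable fun y : ℝ ↦ C * (Real.exp (ε * (1 / 4) ^ 2 + (1 / 4) * u₀) *
      Real.exp (-(ε * y ^ 2))) := by
    have h1 := (integrable_exp_neg_mul_sq hε).const_mul (C * Real.exp (ε * (1 / 4) ^ 2 + (1 / 4) * u₀))
    refine h1.congr (ae_of_all _ fun y ↦ ?_)
    simp only [neg_mul]
    ring
  refine hmaj.mono' hcont.aestronglyMeasurable (Eventually.of_forall fun y ↦ ?_)
  rw [mul_div_right_comm, norm_mul, hK]
  exact mul_le_mul_of_nonneg_right (hG y) (by positivity)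

end OneSided

end Literature.NumberTheory.LFunctions
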